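import Literature.Probability.Distributions.MultivariateGaussianWick
import HarnessLib

/-!
# The Gaussian coupling `ξ = U + V`, `η = U + V'` (lemmas for `GaussianClusterRP.lean`)

THEOREM-ONLY support file for the crux `RotationUpgradeFromTwoPoint` (item stmt-CriticalPhenomena-8367;
line `null-laplacian-edge-gaussianity`), negative side.  Four elementary lemmas used by the sibling file
`GaussianClusterRP.lean` (Gaussian families with a reflection positive two-point kernel are reflection positive at all
orders — the engine behind the kernel-checked Remark 5.14 of the paper draft HOME/nine-mirror-isotropy):

* `pairingSum_congr_of_ne` — the tree's pairing functional `pairingSum` (Wick's law) only evaluates the kernel at pairs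
  of DISTINCT positions;
* `posSemidef_of_diag_dominant` — a symmetric real matrix with dominant diagonal is positive semidefinite;
* `isGaussianProcess_coupling` — on `Ω = ℝ^ι × (ℝ^ι × ℝ^ι)` with a product of three Gaussian measures, the coordinate
  processes `ξ_s = u_s + v_s`, `η_s = u_s + v'_s`, `u_s`, `v_s`, `v'_s` form a Gaussian process (Mathlib
  `ProbabilityTheory.IsGaussianProcess`);
* `integral_coupling_nonneg` — `E[F(U+V) F(U+V')] = ∫ (∫ F(u+v) dμV(v))² dμU(u) ≥ 0` for independent `U ~ μU`,
  `V, V' ~ μV` (Fubini).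

O(3) writer seat, cell pub-ising3x, 2026-08-25; supports item stmt-CriticalPhenomena-8367.  Standard axioms only.
-/

noncomputable section

open MeasureTheory ProbabilityTheory Finset
open Literature.Probability.LatticeModels (pairingSum pairIdx)
open scoped BigOperators

namespace Summit.CriticalPhenomena.Ising3DConformalLimit.RotationUpgradeFromTwoPointNegative

/-! ## §1 Two elementary lemmas -/

/-- The pairing functional only sees the values `S (x i) (x j)` at DISTINCT positions `i ≠ j` (every pair of a
pairing consists of two different positions). [folklore] -/
theorem pairingSum_congr_of_ne {α α' : Type*} (S : α → α → ℝ) (S' : α' → α' → ℝ) (n : ℕ)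
    (x : Fin (2 * n) → α) (x' : Fin (2 * n) → α')
    (h : ∀ i j, i ≠ j → S (x i) (x j) = S' (x' i) (x' j)) :
    pairingSum S n x = pairingSum S' n x' := by
  unfold pairingSum
  congr 1
  refine Finset.sum_congr rfl fun τ _ => Finset.prod_congr rfl fun j _ => h _ _ fun heq => ?_
  have h2 := (pairIdx n).injective (τ.injective heq)
  simp at h2

/-- **Diagonal dominance**: a symmetric real matrix whose diagonal entries dominate the off-diagonal absolute row
sums is positive semidefinite (`vᵀDv ≥ ∑_s v_s² (D_ss − ∑_{t≠s} |D_st|) ≥ 0`). [folklore] -/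
theorem posSemidef_of_diag_dominant {ι : Type*} [Fintype ι] [DecidableEq ι] (D : Matrix ι ι ℝ)
    (hsymm : ∀ s t, D s t = D t s) (hdom : ∀ s, ∑ t, (if s = t then 0 else |D s t|) ≤ D s s) :
    D.PosSemidef := by
  refine Matrix.PosSemidef.of_dotProduct_mulVec_nonneg ?_ fun v => ?_
  · ext s t
    simpa [Matrix.conjTranspose_apply] using hsymm t s
  · have hexp : star v ⬝ᵥ (D.mulVec v) = ∑ s, ∑ t, D s t * (v s * v t) := by
      simp only [dotProduct, Matrix.mulVec, star_trivial, Finset.mul_sum]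
      exact Finset.sum_congr rfl fun s _ => Finset.sum_congr rfl fun t _ => by ring
    rw [hexp]
    -- termwise lower bound
    have hterm : ∀ s t, (if s = t then D s s * v s ^ 2 else 0) - (if s = t then 0 else |D s t|) * v s ^ 2 / 2
        - (if s = t then 0 else |D s t|) * v t ^ 2 / 2 ≤ D s t * (v s * v t) := by
      intro s t
      by_cases hst : s = t
      · subst hst
        simp only [if_true]
        nlinarith [sq_nonneg (v s)]
      · simp only [hst, if_false]
        have h1 : |D s t * (v s * v t)| ≤ |D s t| * (v s ^ 2 + v t ^ 2) / 2 := by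
          rw [abs_mul]
          have hvv : |v s * v t| ≤ (v s ^ 2 + v t ^ 2) / 2 := by
            rw [abs_le]
            constructor <;> nlinarith [sq_nonneg (v s - v t), sq_nonneg (v s + v t)]
          calc |D s t| * |v s * v t| ≤ |D s t| * ((v s ^ 2 + v t ^ 2) / 2) := by gcongr
            _ = |D s t| * (v s ^ 2 + v t ^ 2) / 2 := by ring
        have h2 := neg_abs_le (D s t * (v s * v t))
        linarith
    have hlow : ∑ s, ∑ t, ((if s = t then D s s * v s ^ 2 else 0) - (if s = t then 0 else |D s t|) * v s ^ 2 / 2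
        - (if s = t then 0 else |D s t|) * v t ^ 2 / 2) ≤ ∑ s, ∑ t, D s t * (v s * v t) :=
      Finset.sum_le_sum fun s _ => Finset.sum_le_sum fun t _ => hterm s t
    refine le_trans ?_ hlow
    -- evaluate the lower sum: it equals `∑ s, v s ^ 2 * (D s s - ∑ t, [s ≠ t] |D s t|)`
    have hswap : ∑ s, ∑ t, (if s = t then 0 else |D s t|) * v t ^ 2 / 2 =
        ∑ s, ∑ t, (if s = t then 0 else |D s t|) * v s ^ 2 / 2 := by
      rw [Finset.sum_comm]
      refine Finset.sum_congr rfl fun s _ => Finset.sum_congr rfl fun t _ => ?_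
      by_cases hst : s = t
      · subst hst; simp
      · have hts : ¬ t = s := fun h => hst h.symm
        simp only [hst, hts, if_false, hsymm t s]
    simp only [Finset.sum_sub_distrib]
    rw [hswap]
    have hdiag : ∀ s, ∑ t, (if s = t then D s s * v s ^ 2 else 0) = D s s * v s ^ 2 := fun s => by
      rw [Finset.sum_ite_eq]; simp
    simp only [hdiag]
    rw [← Finset.sum_sub_distrib, ← Finset.sum_sub_distrib]
    refine Finset.sum_nonneg fun s _ => ?_
    have hrow := hdom s
    have hv : 0 ≤ v s ^ 2 := sq_nonneg _
    have hsum : ∑ t, (if s = t then 0 else |D s t|) * v s ^ 2 / 2 =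
        (∑ t, (if s = t then 0 else |D s t|)) * v s ^ 2 / 2 := by
      rw [Finset.sum_mul, Finset.sum_div]
    rw [hsum]
    nlinarith

/-! ## §2 The Gaussian coupling `ξ = U + V`, `η = U + V'` on a product space -/

section Coupling

variable {ι : Type*} [Fintype ι]

/-- The five coordinate processes of the coupling on `Ω = E × (E × E)`, `E = ℝ^ι`: index `0 ↦ ξ_s = u_s + v_s`,
`1 ↦ η_s = u_s + v'_s`, `2 ↦ u_s`, `3 ↦ v_s`, `4 ↦ v'_s`, form a Gaussian process under any product of three Gaussian
measures (each coordinate is a continuous linear functional of `ω`). [folklore] -/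
theorem isGaussianProcess_coupling (μ₁ μ₂ μ₃ : Measure (EuclideanSpace ℝ ι)) [IsGaussian μ₁] [IsGaussian μ₂]
    [IsGaussian μ₃] :
    IsGaussianProcess
      (fun (js : Fin 5 × ι) (ω : EuclideanSpace ℝ ι × (EuclideanSpace ℝ ι × EuclideanSpace ℝ ι)) =>
        if js.1 = 0 then ω.1 js.2 + ω.2.1 js.2 else if js.1 = 1 then ω.1 js.2 + ω.2.2 js.2
        else if js.1 = 2 then ω.1 js.2 else if js.1 = 3 then ω.2.1 js.2 else ω.2.2 js.2)
      (μ₁.prod (μ₂.prod μ₃)) := by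
  classical
  set E := EuclideanSpace ℝ ι
  -- the three coordinate functionals
  let P₁ : E × (E × E) →L[ℝ] E := ContinuousLinearMap.fst ℝ E (E × E)
  let P₂ : E × (E × E) →L[ℝ] E := (ContinuousLinearMap.fst ℝ E E).comp (ContinuousLinearMap.snd ℝ E (E × E))
  let P₃ : E × (E × E) →L[ℝ] E := (ContinuousLinearMap.snd ℝ E E).comp (ContinuousLinearMap.snd ℝ E (E × E))
  let L : Fin 5 × ι → (E × (E × E) →L[ℝ] ℝ) := fun js =>
    if js.1 = 0 then (EuclideanSpace.proj js.2).comp P₁ + (EuclideanSpace.proj js.2).comp P₂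
    else if js.1 = 1 then (EuclideanSpace.proj js.2).comp P₁ + (EuclideanSpace.proj js.2).comp P₃
    else if js.1 = 2 then (EuclideanSpace.proj js.2).comp P₁
    else if js.1 = 3 then (EuclideanSpace.proj js.2).comp P₂ else (EuclideanSpace.proj js.2).comp P₃
  have hL : ∀ (js : Fin 5 × ι) (ω : E × (E × E)), L js ω =
      (if js.1 = 0 then ω.1 js.2 + ω.2.1 js.2 else if js.1 = 1 then ω.1 js.2 + ω.2.2 js.2
        else if js.1 = 2 then ω.1 js.2 else if js.1 = 3 then ω.2.1 js.2 else ω.2.2 js.2) := by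
    rintro ⟨j, s⟩ ω
    fin_cases j <;> simp [L, P₁, P₂, P₃]
  refine ⟨fun I => ?_⟩
  let Lpi : E × (E × E) →L[ℝ] (I → ℝ) := ContinuousLinearMap.pi fun i : I => L (i : Fin 5 × ι)
  have hid : HasGaussianLaw (id : E × (E × E) → E × (E × E)) (μ₁.prod (μ₂.prod μ₃)) :=
    IsGaussian.hasGaussianLaw_id
  have h := hid.map Lpi
  have hfun : (Lpi ∘ id : E × (E × E) → I → ℝ) = fun ω : E × (E × E) => I.restrict fun js : Fin 5 × ι =>
      (if js.1 = 0 then ω.1 js.2 + ω.2.1 js.2 else if js.1 = 1 then ω.1 js.2 + ω.2.2 js.2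
        else if js.1 = 2 then ω.1 js.2 else if js.1 = 3 then ω.2.1 js.2 else ω.2.2 js.2) := by
    funext ω; funext i
    simp only [Function.comp_apply, id_eq, Finset.restrict_def, Lpi, ContinuousLinearMap.pi_apply]
    exact hL i ω
  rwa [hfun] at h

omit [Fintype ι] in
/-- **Positivity of the coupling**: for independent `U ~ μU` and `V, V' ~ μV` (a product measure) and any
function `F` of the coordinates with `F(U+V)F(U+V')` integrable,
`E[F(U+V) F(U+V')] = ∫ (∫ F(u+v) dμV(v))² dμU(u) ≥ 0` (Fubini). [folklore] -/
theorem integral_coupling_nonneg (μU μV : Measure (EuclideanSpace ℝ ι)) [SFinite μU] [SFinite μV]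
    (F : (ι → ℝ) → ℝ)
    (hint : Integrable (fun ω : EuclideanSpace ℝ ι × (EuclideanSpace ℝ ι × EuclideanSpace ℝ ι) =>
      F (fun s => ω.1 s + ω.2.1 s) * F (fun s => ω.1 s + ω.2.2 s)) (μU.prod (μV.prod μV))) :
    0 ≤ ∫ ω, F (fun s => ω.1 s + ω.2.1 s) * F (fun s => ω.1 s + ω.2.2 s) ∂(μU.prod (μV.prod μV)) := by
  rw [integral_prod _ hint]
  refine integral_nonneg fun u => ?_
  have h := integral_prod_mul (μ := μV) (ν := μV) (fun v : EuclideanSpace ℝ ι => F (fun s => u s + v s))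
    (fun v : EuclideanSpace ℝ ι => F (fun s => u s + v s))
  dsimp only at h ⊢
  rw [h]
  exact mul_self_nonneg _

end Coupling

end Summit.CriticalPhenomena.Ising3DConformalLimit.RotationUpgradeFromTwoPointNegative

end
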